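import Summits.BirchSwinnertonDyer.BirchSwinnertonDyer.Theorems.SylvesterTwoHeegnerIndexUpperOffV0DescentSharp
import Summits.BirchSwinnertonDyer.BirchSwinnertonDyer.Theorems.SylvesterTwoHeegnerIndexUpperOffV0DescentTwoOfLeaves
import HarnessLib

/-!
# K7t crux `UpperOffV0HSYPlus` (item 19804), line `offv0-kolyvagin2`: the 2-adic descent from the
# leaves, SHARP — `2^{M₀+2} · S_{2^M}(E/K) ⊆ ℤ δ_M x₀` for the CM curves `y² = x³ − c`

Route `SylvesterTwoHeegnerIndex` (cell bsd-cm, rung K7t); stub (U1)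
`stub_shaTwoExponentSharpOffV0B_of_kolyvaginDescent_two` of the registered VARIANT E skeleton (planner
g22, D135) asks for the sharp 2-adic Kolyvagin exponent.  The landed `descentTwo_of_leaves`
(`…UpperOffV0DescentTwoOfLeaves`, p470866) feeds the parity-free count `descent_defect'` and returns
`2^{2M₀+4} S_{2^M}(E/K) ⊆ ℤ δ_M x₀`.  This file is its SHARP twin, fed by
`DescentDefect.descent_sharp_defect` (`…UpperOffV0DescentSharp`: two-place duality,
`2 · p^{M₀+δ} · Sel ⊆ ℤ x`, no socle instance):

* `descentTwoSharp_of_leaves` — **`2^{M₀+2} S_{2^M}(E/K) ⊆ ℤ δ_M x₀`** from leaf (A) = the shape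
  produced from stub (d″), leaf (B) in descent form with defect one (one place, from stub (e) by
  `hdual_two_of_kolyvaginReciprocityM`) and the NEW leaf (B₂): the descent form with defect one of
  McCallum's reciprocity over TWO Kolyvagin places `{λ, λ'}` for a `ν`-eigenclass Selmer off
  `{λ, λ'}` against a Selmer `ν`-eigenclass vanishing at `λ'` (from the finset reciprocity (R_T)_M,
  `…UpperOffV0ReciprocityFinsetTwoOfPoitouTate`, by `hdual₂_two_of_kolyvaginReciprocityFinsetM` in
  `…UpperOffV0ShaBoundTwoSharp`); Čebotarev at `2` discharged by the tree
  (`exists_kolyvaginPrime_gt_twoPow_holds`, p449935).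

HONEST FRAMING.  Two powers of `2` above Kolyvagin's `C = 2^{M₀}` remain (`δ = 1` in Lemma 5.3 at
`2`, intrinsic to `τ`-eigen classes — k7t-c2 g5 §5 / g7 ISOTROPY p494364 — and the decomposition
`2s = s⁺ + s⁻`); NOT stub (U1), NOT the crux; no named fact, no definition, no `sorry`; B14 = O12 open
as a class; BSD not claimed. [McCallumLMS1991 §§2–5; GrossLMS1991 Thm. 1.3, §10]
-/

noncomputable section

open scoped Classical
open WeierstrassCurve NumberField IsDedekindDomain Field Literature.NumberTheory.EllipticCurves
  Literature.NumberTheory.GaloisRepresentations Literature.NumberTheory.EllipticCurves.KolyvaginDescent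

set_option autoImplicit false
set_option linter.dupNamespace false

namespace Summit.BirchSwinnertonDyer.BirchSwinnertonDyer.Theorems.SylvesterTwoUpper

universe u

section Leaves

variable {N : ℕ} [NeZero N] {W : WeierstrassCurve ℚ} {K : Type u} [Field K] [NumberField K]

set_option maxHeartbeats 800000 in
/-- **Kolyvagin's descent modulo `2^M` from the leaves, SHARP, for `y² = x³ − c`:
`2^{M₀+2} S_{2^M}(E/K) ⊆ ℤ δ_M x₀`.**  Inputs of `descentTwo_of_leaves` (p470866: `K` imaginary
quadratic with conjugation `c`, `E(K)[2] = 0`, `P = 2^{M₀} x₀` with `δ_M P = 2^{M₀} δ_M x₀` and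
`2^{M-1} δ_M x₀ ≠ 0`, the sign `ε` of `P`, leaf (A) `cl`/`hc1`/`hcl`, leaf (B) in descent form with
defect one `hdual`, the model data `C • W = y² = x³ − c`, `∛c ∉ K`, `ω ∉ K` for Čebotarev at `2`)
PLUS the two-place leaf (B₂) `hdual₂` — the descent form with defect one of McCallum's reciprocity
over the two Kolyvagin places `{λ, λ'}` for a `ν`-eigenclass `d` Selmer off `{λ, λ'}` against a
Selmer `ν`-eigenclass `s` VANISHING at `λ'` (`2^a d_λ ≠ 0 ⟹ 2^{M-1-a+1} s_λ = 0`;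
`hdual₂_two_of_kolyvaginReciprocityFinsetM` derives it from (R_T)_M).  Output: the conclusion of
`DescentDefect.descent_sharp_defect` at `p = 2`, `δ = 1` — exponent `M₀ + 2` in place of `2M₀ + 4`,
with ONE Čebotarev input (`exists_kolyvaginPrime_gt_twoPow_holds`; no socle instance).
[cite: McCallumLMS1991, §1 Theorem (Kolyvagin), §2 Prop. 2.2, §§3–5] [cite: GrossLMS1991, Thm. 1.3, §10] -/
theorem descentTwoSharp_of_leaves [W.IsElliptic] (hK : IsImaginaryQuadratic K)
    {C : VariableChange ℚ} {cM : ℚ} (hCW : C • W = ⟨0, 0, 0, 0, -cM⟩)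
    (hcube : ∀ x : K, x ^ 3 ≠ (cM : K)) (hωK : ∀ x : K, x ^ 2 + x + 1 ≠ 0)
    {P : (W.baseChange K).toAffine.Point} {M : ℕ} (hM : 1 ≤ M)
    (hdiv : ∀ Q : geomPoints (W.baseChange K), ∃ R, ((2 ^ M : ℕ) : ℤ) • R = Q)
    {c : K ≃ₐ[ℚ] K} (hc : c ≠ 1) (hcc : c * c = 1)
    (hA2 : ∀ a : (W.baseChange K).toAffine.Point, 2 • a = 0 → a = 0)
    {M₀ : ℕ} {x₀ : (W.baseChange K).toAffine.Point} (hx₀ : 2 ^ M₀ • x₀ = P)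
    (hPx : kummerMapTorsion (W.baseChange K) _ hdiv P =
      (((2 : ℕ) : ℤ) ^ M₀) • kummerMapTorsion (W.baseChange K) _ hdiv x₀)
    (hxord : (((2 : ℕ) : ℤ) ^ (M - 1)) • kummerMapTorsion (W.baseChange K) _ hdiv x₀ ≠ 0)
    (ε : ℤ) (hε : ε = 1 ∨ ε = -1)
    (h53 : IsOfFinAddOrder (Affine.Point.map (W' := W) (c : K →ₐ[ℚ] K) P - ε • P))
    (cl : ℕ → galH1Torsion (W.baseChange K) ((2 ^ M : ℕ) : ℤ))
    (hc1 : cl 1 = kummerMapTorsion (W.baseChange K) _ hdiv P)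
    (hcl : ∀ m : ℕ, Squarefree m →
      (∀ q ∈ m.primeFactors, IsKolyvaginPrime N W K 2 q ∧ FrobEqFrobInfty W K (2 ^ M) q) →
      conjAct W c _ (cl m) = (ε * (-1) ^ m.primeFactors.card) • cl m ∧
      (∀ v : HeightOneSpectrum (𝓞 K), (m : 𝓞 K) ∉ v.asIdeal →
        cl m ∈ selmerLocalKer (W.baseChange K) (v.adicCompletion K) ((2 ^ M : ℕ) : ℤ)) ∧
      (∀ ℓ : ℕ, ℓ.Prime → ℓ ∣ m → ∀ v : HeightOneSpectrum (𝓞 K), (ℓ : 𝓞 K) ∈ v.asIdeal →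
        ∀ a : ℕ, ((((2 : ℕ) : ℤ) ^ a) • cl m ∈
            selmerLocalKer (W.baseChange K) (v.adicCompletion K) ((2 ^ M : ℕ) : ℤ) ↔
          (((2 : ℕ) : ℤ) ^ a) • cl (m / ℓ) ∈
            (W.baseChange K).torsionLocalKer (v.adicCompletion K) ((2 ^ M : ℕ) : ℤ))))
    (hdual : ∀ ℓ : ℕ, IsKolyvaginPrime N W K 2 ℓ ∧ FrobEqFrobInfty W K (2 ^ M) ℓ →
      ∀ ν : ℤ, (ν = 1 ∨ ν = -1) → ∀ d : galH1Torsion (W.baseChange K) ((2 ^ M : ℕ) : ℤ),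
      conjAct W c _ d = ν • d →
      (∀ v : HeightOneSpectrum (𝓞 K), (ℓ : 𝓞 K) ∉ v.asIdeal →
        d ∈ selmerLocalKer (W.baseChange K) (v.adicCompletion K) ((2 ^ M : ℕ) : ℤ)) →
      (∀ w : InfinitePlace K, d ∈ selmerLocalKer (W.baseChange K) w.Completion ((2 ^ M : ℕ) : ℤ)) →
      ∀ s ∈ selmerGroup (W.baseChange K) ((2 ^ M : ℕ) : ℤ), conjAct W c _ s = ν • s →
      ∀ a : ℕ, a < M → ∀ v : HeightOneSpectrum (𝓞 K), (ℓ : 𝓞 K) ∈ v.asIdeal →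
        (((2 : ℕ) : ℤ) ^ a) • d ∉
          selmerLocalKer (W.baseChange K) (v.adicCompletion K) ((2 ^ M : ℕ) : ℤ) →
        (((2 : ℕ) : ℤ) ^ (M - 1 - a + 1)) • s ∈
          (W.baseChange K).torsionLocalKer (v.adicCompletion K) ((2 ^ M : ℕ) : ℤ))
    (hdual₂ : ∀ ℓ ℓ' : ℕ, IsKolyvaginPrime N W K 2 ℓ ∧ FrobEqFrobInfty W K (2 ^ M) ℓ →
      IsKolyvaginPrime N W K 2 ℓ' ∧ FrobEqFrobInfty W K (2 ^ M) ℓ' → ℓ ≠ ℓ' →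
      ∀ ν : ℤ, (ν = 1 ∨ ν = -1) → ∀ d : galH1Torsion (W.baseChange K) ((2 ^ M : ℕ) : ℤ),
      conjAct W c _ d = ν • d →
      (∀ v : HeightOneSpectrum (𝓞 K), (ℓ : 𝓞 K) ∉ v.asIdeal → (ℓ' : 𝓞 K) ∉ v.asIdeal →
        d ∈ selmerLocalKer (W.baseChange K) (v.adicCompletion K) ((2 ^ M : ℕ) : ℤ)) →
      (∀ w : InfinitePlace K, d ∈ selmerLocalKer (W.baseChange K) w.Completion ((2 ^ M : ℕ) : ℤ)) →
      ∀ s ∈ selmerGroup (W.baseChange K) ((2 ^ M : ℕ) : ℤ), conjAct W c _ s = ν • s →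
      (∀ v : HeightOneSpectrum (𝓞 K), (ℓ' : 𝓞 K) ∈ v.asIdeal →
        s ∈ (W.baseChange K).torsionLocalKer (v.adicCompletion K) ((2 ^ M : ℕ) : ℤ)) →
      ∀ a : ℕ, a < M → ∀ v : HeightOneSpectrum (𝓞 K), (ℓ : 𝓞 K) ∈ v.asIdeal →
        (((2 : ℕ) : ℤ) ^ a) • d ∉
          selmerLocalKer (W.baseChange K) (v.adicCompletion K) ((2 ^ M : ℕ) : ℤ) →
        (((2 : ℕ) : ℤ) ^ (M - 1 - a + 1)) • s ∈
          (W.baseChange K).torsionLocalKer (v.adicCompletion K) ((2 ^ M : ℕ) : ℤ))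
    {s : galH1Torsion (W.baseChange K) ((2 ^ M : ℕ) : ℤ)}
    (hs : s ∈ selmerGroup (W.baseChange K) ((2 ^ M : ℕ) : ℤ)) :
    (2 * ((2 : ℕ) : ℤ) ^ (M₀ + 1)) • s ∈
      AddSubgroup.zmultiples (kummerMapTorsion (W.baseChange K) _ hdiv x₀) := by
  -- `E(K)[2] = 0`
  have hA : ∀ a : (W.baseChange K).toAffine.Point, 2 • a = 0 → a = 0 := hA2
  -- `τ x = ε x`
  set x := kummerMapTorsion (W.baseChange K) _ hdiv x₀ with hxdef
  have hτx : conjAct W c _ x = ε • x := by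
    rw [hxdef, conjAct_kummerMapTorsion W c _ hdiv x₀]
    set t := Affine.Point.map (W' := W) (c : K →ₐ[ℚ] K) x₀ - ε • x₀ with ht
    have htP : 2 ^ M₀ • t = Affine.Point.map (W' := W) (c : K →ₐ[ℚ] K) P - ε • P := by
      rw [ht, smul_sub, ← map_nsmul, hx₀, smul_comm, hx₀]
    have htors : IsOfFinAddOrder t := by
      obtain ⟨k, hk, hkt⟩ := (isOfFinAddOrder_iff_nsmul_eq_zero).mp h53
      refine (isOfFinAddOrder_iff_nsmul_eq_zero).mpr
        ⟨k * 2 ^ M₀, Nat.mul_pos hk (pow_pos two_pos _), ?_⟩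
      rw [mul_smul, htP, hkt]
    obtain ⟨s, hs⟩ := exists_pow_smul_eq_of_isOfFinAddOrder Nat.prime_two hA htors M
    have hker : t ∈ (kummerMapTorsion (W.baseChange K) ((2 ^ M : ℕ) : ℤ) hdiv).ker := by
      rw [kummerMapTorsion_ker]
      exact ⟨s, by rw [← hs, Nat.cast_pow]; rfl⟩
    have ht0 : kummerMapTorsion (W.baseChange K) _ hdiv t = 0 := hker
    have : Affine.Point.map (W' := W) (c : K →ₐ[ℚ] K) x₀ = t + ε • x₀ := by rw [ht]; abel
    rw [this, map_add, ht0, zero_add, map_zsmul]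
  -- the local conditions at the (complex) infinite places are empty
  have hinf : ∀ (w : InfinitePlace K) (y : galH1Torsion (W.baseChange K) ((2 ^ M : ℕ) : ℤ)),
      y ∈ selmerLocalKer (W.baseChange K) w.Completion ((2 ^ M : ℕ) : ℤ) := fun w y ↦ by
    haveI : IsAlgClosed w.Completion :=
      isAlgClosed_of_ringEquiv (InfinitePlace.Completion.ringEquivComplexOfIsComplex
        (hK.2.isComplex w)).symm
    rw [WeierstrassCurve.selmerLocalKer_eq_top_of_isAlgClosed]
    trivial
  -- the SHARP parity-free count at `p = 2`, `δ = 1`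
  refine DescentDefect.descent_sharp_defect (p := 2) (M := M) (M₀ := M₀) (δ := 1)
    (Pl := HeightOneSpectrum (𝓞 K) ⊕ InfinitePlace K)
    (τ := conjAct W c _) (Sel := selmerGroup (W.baseChange K) _)
    (Loc := Sum.elim (fun v ↦ selmerLocalKer (W.baseChange K) (v.adicCompletion K) _)
      (fun w ↦ selmerLocalKer (W.baseChange K) w.Completion _))
    (Kol := fun ℓ ↦ IsKolyvaginPrime N W K 2 ℓ ∧ FrobEqFrobInfty W K (2 ^ M) ℓ)
    (pl := fun ℓ ↦ if h : IsKolyvaginPrime N W K 2 ℓ ∧ FrobEqFrobInfty W K (2 ^ M) ℓ then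
      Sum.inl h.1.place else Sum.inr (Classical.arbitrary _))
    (Dv := fun v n ↦ Sum.elim (fun v ↦ (n : 𝓞 K) ∈ v.asIdeal) (fun _ ↦ False) v)
    (A := fun ℓ ↦ ⨅ (v : HeightOneSpectrum (𝓞 K)) (_ : (ℓ : 𝓞 K) ∈ v.asIdeal),
      (W.baseChange K).torsionLocalKer (v.adicCompletion K) _)
    (x := x) (ε := ε) (c := cl) Nat.prime_two ?_ ?_ ?_ ?_ ?_ ?_ ?_ hxord hε hτx ?_ ?_ ?_ ?_ ?_
    ?_ ?_ hs
  · -- torsion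
    intro v
    have := zsmul_discreteH1_torsion ((2 ^ M : ℕ) : ℤ) v
    exact_mod_cast this
  · -- τ_τ
    exact conjAct_conjAct_of_mul_self W hcc _
  · -- τ_mem
    exact fun s hs ↦ conjAct_mem_selmerGroup W hK.2.isComplex c _ hs
  · -- prime_of_kol
    exact fun ℓ h ↦ h.1.prime
  · -- dv_iff
    intro ℓ hℓ v
    rw [dif_pos hℓ]
    rcases v with v | w
    · simp only [Sum.elim_inl, Sum.inl.injEq]
      exact hℓ.1.mem_iff
    · simp
  · -- dv_mul
    intro ℓ ℓ' _ _ v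
    rcases v with v | w
    · exact natCast_mul_mem_asIdeal
    · simp
  · -- x_mem
    exact (mem_selmerGroup_iff _ _ _).mpr
      ⟨fun _ ↦ kummerMapTorsion_mem_selmerLocalKer _ _ _ _ x₀,
        fun _ ↦ kummerMapTorsion_mem_selmerLocalKer _ _ _ _ x₀⟩
  · -- c_one
    rw [hc1, hPx]
  · -- τ_c
    exact fun n hn ↦ (hcl n hn.1 hn.2).1
  · -- c_mem_loc
    intro n hn v hv
    rcases v with v | w
    · exact (hcl n hn.1 hn.2).2.1 v hv
    · exact hinf w (cl n)
  · -- c_mem_loc_iff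
    intro ℓ m hℓ hn a
    rw [dif_pos hℓ]
    simp only [Sum.elim_inl, AddSubgroup.mem_iInf]
    have key := (hcl (ℓ * m) hn.1 hn.2).2.2 ℓ hℓ.1.prime (dvd_mul_right ℓ m) hℓ.1.place
      hℓ.1.mem_place a
    rw [Nat.mul_div_cancel_left m hℓ.1.prime.pos] at key
    rw [key]
    constructor
    · intro h v hv
      rwa [hℓ.1.mem_iff.mp hv]
    · intro h
      exact h hℓ.1.place hℓ.1.mem_place
  · -- duality (defect one)
    intro ℓ hℓ ν hν d hd hoff s hs hτs a ha hat
    rw [dif_pos hℓ] at hoff hat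
    simp only [AddSubgroup.mem_iInf]
    intro v hv
    refine hdual ℓ hℓ ν hν d hd (fun v' hv' ↦ ?_) (fun w ↦ ?_) s hs hτs a ha v hv ?_
    · exact hoff (Sum.inl v') (fun h ↦ hv' (hℓ.1.mem_iff.mpr (Sum.inl_injective h)))
    · exact hoff (Sum.inr w) (by simp)
    · rwa [hℓ.1.mem_iff.mp hv]
  · -- duality₂ (two places, defect one)
    intro ℓ ℓ' hℓ hℓ' hne ν hν d hd hoff s hs hτs hsA a ha hat
    rw [dif_pos hℓ, dif_pos hℓ'] at hoff
    rw [dif_pos hℓ] at hat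
    simp only [AddSubgroup.mem_iInf] at hsA ⊢
    intro v hv
    refine hdual₂ ℓ ℓ' hℓ hℓ' hne ν hν d hd (fun v' hv'₁ hv'₂ ↦ ?_) (fun w ↦ ?_) s hs hτs hsA a ha v hv
      ?_
    · exact hoff (Sum.inl v') (fun h ↦ hv'₁ (hℓ.1.mem_iff.mpr (Sum.inl_injective h)))
        (fun h ↦ hv'₂ (hℓ'.1.mem_iff.mpr (Sum.inl_injective h)))
    · exact hoff (Sum.inr w) (by simp) (by simp)
    · rwa [hℓ.1.mem_iff.mp hv]
  · -- cebotarev := Cor. 3.2 at `2` (independent eigen-families), Čebotarev a tree theorem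
    intro r cs Nv h0 hN hτ hind b
    choose ex hex1 hexM hex hexmin hord using fun i ↦
      exists_addOrderOf_eq_pow (W.baseChange K) Nat.prime_two M (hx := h0 i)
    have hind' : ∀ a : Fin r → ℤ, ∑ i, a i • cs i = 0 → ∀ i, ((2 : ℤ) ^ ex i) ∣ a i := by
      intro a ha i
      have h := (addOrderOf_dvd_iff_zsmul_eq_zero).mpr (hind a ha i)
      rw [hord i, Nat.cast_pow] at h
      exact_mod_cast h
    have hNe : ∀ i, Nv i ≤ ex i := fun i ↦ by
      by_contra hlt
      have hlt := Nat.lt_of_not_le hlt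
      have hk : (((2 : ℕ) : ℤ) ^ (Nv i - 1)) • cs i = 0 := by
        have : Nv i - 1 = (Nv i - 1 - ex i) + ex i := by omega
        rw [this, pow_add, mul_smul, hex i]
        exact zsmul_zero _
      exact hN i (by omega) hk
    have hNM : ∀ i, Nv i ≤ M := fun i ↦ (hNe i).trans (hexM i)
    obtain ⟨ℓ, hbℓ, hℓ, hℓN, hℓD, hℓp, hprime, hfrob, hloc⟩ :=
      exists_kolyvaginPrime_gt_twoPow_holds (N := N) W hCW hK hcube hωK hM hc cs hτ ex
        (fun i ↦ by exact_mod_cast hex i) hind' Nv hNe hNM b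
    refine ⟨ℓ, hbℓ, ⟨⟨hℓ, hℓN, hℓD, hℓp, hprime, hfrob.of_dvd (dvd_pow_self 2 (by omega))⟩, hfrob⟩,
      fun i ↦ ⟨?_, fun hNi h ↦ ?_⟩⟩
    · simp only [AddSubgroup.mem_iInf]
      intro v hv
      exact_mod_cast (hloc i v hv).1
    · simp only [AddSubgroup.mem_iInf] at h
      have hK₀ : IsKolyvaginPrime N W K 2 ℓ :=
        ⟨hℓ, hℓN, hℓD, hℓp, hprime, hfrob.of_dvd (dvd_pow_self 2 (by omega))⟩
      exact (hloc i hK₀.place hK₀.mem_place).2 hNi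
        (by exact_mod_cast h hK₀.place hK₀.mem_place)

end Leaves

end Summit.BirchSwinnertonDyer.BirchSwinnertonDyer.Theorems.SylvesterTwoUpper

end
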